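import Mathlib
import Summits.Ventures.HodgeRepro.Tier4.Target
import Summits.Ventures.HodgeRepro.Tier4.Common.TargetBall
import Summits.Ventures.HodgeRepro.Tier4.Line3.BallChangeOfVariables

/-!
# Tier4/Line3/ScalarAction — a matrix acting trivially on the ball is a scalar (L3.6a, the centre count)

Blind re-derivation cell `pub-hodge-repro`, Tier 4 «PROVE THE STEP» (README §9–§10), LINE L3, seat t4-L3-p1 (prover);
support (S4d-3) of L3.6a `term_main_unfold` (lead S12253): the kernel of `γ ↦ actM (toBallMat τ₀ C γ)` on a congruence
subgroup consists of the scalar matrices of the subgroup (`centerCard` of the skeleton's class sum).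

CONTENT.  `actM M z = z` means `M (z, 1) = λ(z) (z, 1)` with `λ(z) = (M (z,1))₂`.  Evaluating at the five points
`0, (1/2, 0), (1/4, 0), (0, 1/2), (0, 1/4)` of the ball gives the nine entries: `M = M₂₂ · 1` (`eq_smul_one_of_actM_eq`).
Conversely a scalar `t • 1` with `t ≠ 0` acts trivially on all of `ℂ²` (`actM_smul_one`).  For `M ∈ U(2,1)` the
denominators `λ(z)` are non-zero on the ball (`mulVec_lift3_two_ne_zero`), which is the only use of `U(2,1)`.

Nothing here asserts anything about the truth of (P); HC_CM is NOT proved by anyone in this repository.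
-/

set_option autoImplicit false

noncomputable section

namespace Summit.Ventures.HodgeRepro.Tier4.Line3

open Summit.Ventures.HodgeRepro.Tier4
open Matrix

section Scalar

variable {M : Matrix (Fin 3) (Fin 3) ℂ} {z : Fin 2 → ℂ}

/-- The coordinates of `M (z, 1)`. -/
theorem mulVec_lift3_eq (M : Matrix (Fin 3) (Fin 3) ℂ) (z : Fin 2 → ℂ) (i : Fin 3) :
    (M *ᵥ lift3 z) i = M i 0 * z 0 + M i 1 * z 1 + M i 2 := by
  simp [Matrix.mulVec, dotProduct, lift3, Fin.sum_univ_three]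

/-- If `actM M z = z` with non-zero denominator, then `M (z,1) = λ (z,1)` coordinatewise: the two equations
`M_{k0} z₀ + M_{k1} z₁ + M_{k2} = (M_{20} z₀ + M_{21} z₁ + M_{22}) z_k`. -/
theorem fixed_eq (h2 : (M *ᵥ lift3 z) 2 ≠ 0) (hz : actM M z = z) (k : Fin 2) :
    M (Fin.castSucc k) 0 * z 0 + M (Fin.castSucc k) 1 * z 1 + M (Fin.castSucc k) 2 =
      (M 2 0 * z 0 + M 2 1 * z 1 + M 2 2) * z k := by
  have h := congrFun hz k
  simp only [actM] at h
  rw [div_eq_iff h2] at h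
  rw [mulVec_lift3_eq, mulVec_lift3_eq] at h
  rw [h, mul_comm]

/-- **A MATRIX OF `U(2,1)` FIXING THE BALL POINTWISE IS SCALAR**: `M = M₂₂ • 1`. -/
theorem eq_smul_one_of_actM_eq (hM : Mᴴ * J * M = J) (h : ∀ z ∈ ball, actM M z = z) :
    M = M 2 2 • (1 : Matrix (Fin 3) (Fin 3) ℂ) := by
  -- the five evaluation points
  have mem : ∀ a b : ℝ, a ^ 2 + b ^ 2 < 1 → (![(a : ℂ), (b : ℂ)] : Fin 2 → ℂ) ∈ ball := by
    intro a b hab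
    show nsq _ < 1
    simp [nsq, Complex.norm_real, hab]
  have e : ∀ a b : ℝ, a ^ 2 + b ^ 2 < 1 → ∀ k : Fin 2,
      M (Fin.castSucc k) 0 * (a : ℂ) + M (Fin.castSucc k) 1 * (b : ℂ) + M (Fin.castSucc k) 2 =
        (M 2 0 * (a : ℂ) + M 2 1 * (b : ℂ) + M 2 2) * (![(a : ℂ), (b : ℂ)] : Fin 2 → ℂ) k := by
    intro a b hab k
    have hz := mem a b hab
    have := fixed_eq (mulVec_lift3_two_ne_zero hM hz) (h _ hz) k
    simpa using this
  have e00 := e 0 0 (by norm_num) 0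
  have e01 := e 0 0 (by norm_num) 1
  have e10 := e (1/2) 0 (by norm_num) 0
  have e11 := e (1/2) 0 (by norm_num) 1
  have e20 := e (1/4) 0 (by norm_num) 0
  have e30 := e 0 (1/2) (by norm_num) 0
  have e31 := e 0 (1/2) (by norm_num) 1
  have e41 := e 0 (1/4) (by norm_num) 1
  simp only [Matrix.cons_val_zero, Matrix.cons_val_one, Fin.castSucc_zero,
    Fin.castSucc_one, Complex.ofReal_zero, Complex.ofReal_div, Complex.ofReal_one, Complex.ofReal_ofNat,
    mul_zero, zero_add, add_zero] at e00 e01 e10 e11 e20 e30 e31 e41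
  -- solve the nine entries
  have h02 : M 0 2 = 0 := by linear_combination e00
  have h12 : M 1 2 = 0 := by linear_combination e01
  have h20 : M 2 0 = 0 := by linear_combination (-8 : ℂ) * e10 + (16 : ℂ) * e20 - (8 : ℂ) * h02
  have h00 : M 0 0 = M 2 2 := by linear_combination (2 : ℂ) * e10 - (2 : ℂ) * h02 + (1 / 2 : ℂ) * h20
  have h10 : M 1 0 = 0 := by linear_combination (2 : ℂ) * e11 - (2 : ℂ) * h12
  have h21 : M 2 1 = 0 := by linear_combination (-8 : ℂ) * e31 + (16 : ℂ) * e41 - (8 : ℂ) * h12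
  have h11 : M 1 1 = M 2 2 := by linear_combination (2 : ℂ) * e31 - (2 : ℂ) * h12 + (1 / 2 : ℂ) * h21
  have h01 : M 0 1 = 0 := by linear_combination (2 : ℂ) * e30 - (2 : ℂ) * h02
  ext i j
  fin_cases i <;> fin_cases j <;>
    simp [Matrix.smul_apply, h00, h01, h02, h10, h11, h12, h20, h21]

/-- A non-zero scalar matrix acts trivially on all of `ℂ²`. -/
theorem actM_smul_one {t : ℂ} (ht : t ≠ 0) (z : Fin 2 → ℂ) : actM (t • (1 : Matrix (Fin 3) (Fin 3) ℂ)) z = z := by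
  funext k
  simp only [actM, Matrix.smul_mulVec, Matrix.one_mulVec, Pi.smul_apply, smul_eq_mul]
  rw [show lift3 z 2 = 1 from rfl, mul_one, mul_div_cancel_left₀ _ ht]
  fin_cases k <;> rfl

/-- **THE KERNEL OF THE ACTION**: for `M ∈ U(2,1)`, `actM M` is the identity on the ball iff `M` is a scalar. -/
theorem actM_eq_id_iff (hM : Mᴴ * J * M = J) :
    (∀ z ∈ ball, actM M z = z) ↔ ∃ t : ℂ, t ≠ 0 ∧ M = t • (1 : Matrix (Fin 3) (Fin 3) ℂ) := by
  constructor
  · intro h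
    refine ⟨M 2 2, ?_, eq_smul_one_of_actM_eq hM h⟩
    intro h0
    have hdet := det_ne_zero_of_unitaryJ hM
    rw [eq_smul_one_of_actM_eq hM h, h0, zero_smul, Matrix.det_zero] at hdet
    exact hdet rfl
  · rintro ⟨t, ht, rfl⟩ z _
    exact actM_smul_one ht z

end Scalar

end Summit.Ventures.HodgeRepro.Tier4.Line3

end
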